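import Mathlib
import HarnessLib

/-!
# `NoHeavyLowerTail` (crux stmt-CriticalPhenomena-4575), antithetic vdBHK programme: the DIAGONAL DECOMPOSITION of the rearrangement functional and the
# NEUTRALITY SKELETON (THEOREM S⁺: hanging a new atom below any atom of a rooted poset neither destroys nor creates a failure of (R))

Support file (seat `prim-ineq-gen-7` gen 54; `--supports stmt-CriticalPhenomena-4575`).  No `sorry`, no definitions.  Companion of `AntitheticStalk`
(the transfer identity `R_Z(𝐀*,𝐁*) = R_T(𝐀,𝐁)` for the template pair).  Memo: run/shared/lean/prim/prim-ineq-gen-7/FINDING-STALK-g54.md §2b (THEOREM S⁺).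

SETTING (memo §1–2).  `Z = TQ′` is the colouring poset carrying the rearrangement functional `R_Z(𝐀′,𝐁′) = #(𝐀′ ∩ 𝐁′) - #{z ∈ 𝐀′ : κ z ∈ 𝐁′}` of the
rooted poset `(Q_u, a′)` obtained from `(Q,a)` by hanging a new atom `e` below the atom `u`; `κ` is its wedge flip; `D ⊆ Z` is the DIAGONAL (`e` coloured
like `u`), `κ`-stable, and `δ : T → D` is the order isomorphism from `T = TQ` (the functional of `(Q,a)`, flip `ι′`) with `κ ∘ δ = δ ∘ ι′`.  The complement
`Z ∖ D` (the ANTIDIAGONAL) with its induced order is a PRODUCT `Ω_{Q∖↑u} × C₂ × 2^{↑u∖u}` of polarized involution posets (memo LEMMA D, machine-verified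
on 280 bases), so its own rearrangement functional is `≥ 0` by THEOREM R₀ (`AntitheticWedgeProduct.product_R`), Kleitman's lemma and descent — whenever
(R) holds for `(Q,a)`.  This file proves the two purely finite-set steps:
* `AntitheticStalkSplit.R_split` — for a `κ`-stable `D`, `R_Z(𝐀,𝐁) = R_Z(𝐀∩D, 𝐁∩D) + R_Z(𝐀∖D, 𝐁∖D)` (the functional splits over `D ⊔ Dᶜ`);
* `AntitheticStalkSplit.R_diag_eq` — the `D`-part equals `R_T(δ⁻¹𝐀, δ⁻¹𝐁)` when `δ` is injective onto `D` and intertwines `ι′, κ`;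
* `AntitheticStalkSplit.neutrality_skeleton` — **THEOREM S⁺ skeleton**: if `R_T ≥ m` on the pulled-back pair and the antidiagonal part is `≥ 0`, then
  `R_Z(𝐀,𝐁) ≥ m`; with `m = 0` and `AntitheticStalk.stalk_transfer` (which attains `R_T`): `min R_Z = min R_T`, i.e. `(R)(Q_u,a′) ⟺ (R)(Q,a)` (memo THEOREM S⁺).
-/

namespace Summit.CriticalPhenomena.PercolationContinuityZ3.Theorems

open Finset

namespace AntitheticStalkSplit

variable {T Z : Type*} [DecidableEq T] [DecidableEq Z]

/-- **Splitting the rearrangement functional over a `κ`-stable set.**  If `z ∈ D ↔ κ z ∈ D` for all `z`, then for all finite `A, B ⊆ Z`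
`#(A ∩ B) - #{z ∈ A : κ z ∈ B} = (#((A∩D) ∩ (B∩D)) - #{z ∈ A∩D : κ z ∈ B∩D}) + (#((A∖D) ∩ (B∖D)) - #{z ∈ A∖D : κ z ∈ B∖D})` over `ℤ`. [this work] -/
theorem R_split (κ : Z → Z) (D : Finset Z) (hD : ∀ z, z ∈ D ↔ κ z ∈ D) (A B : Finset Z) :
    ((A ∩ B).card : ℤ) - ((A.filter (fun z => κ z ∈ B)).card : ℤ)
      = (((A ∩ D) ∩ (B ∩ D)).card : ℤ) - (((A ∩ D).filter (fun z => κ z ∈ B ∩ D)).card : ℤ)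
        + ((((A \ D) ∩ (B \ D)).card : ℤ) - (((A \ D).filter (fun z => κ z ∈ B \ D)).card : ℤ)) := by
  classical
  have e1 : (A ∩ B).card = ((A ∩ B).filter (fun z => z ∈ D)).card + ((A ∩ B).filter (fun z => z ∉ D)).card := by
    rw [Finset.card_filter_add_card_filter_not]
  have e2 : (A.filter (fun z => κ z ∈ B)).card =
      ((A.filter (fun z => κ z ∈ B)).filter (fun z => z ∈ D)).card + ((A.filter (fun z => κ z ∈ B)).filter (fun z => z ∉ D)).card := by
    rw [Finset.card_filter_add_card_filter_not]
  have i1 : (A ∩ B).filter (fun z => z ∈ D) = (A ∩ D) ∩ (B ∩ D) := by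
    ext z; simp only [Finset.mem_filter, Finset.mem_inter]; tauto
  have i2 : (A ∩ B).filter (fun z => z ∉ D) = (A \ D) ∩ (B \ D) := by
    ext z; simp only [Finset.mem_filter, Finset.mem_inter, Finset.mem_sdiff]; tauto
  have i3 : (A.filter (fun z => κ z ∈ B)).filter (fun z => z ∈ D) = (A ∩ D).filter (fun z => κ z ∈ B ∩ D) := by
    ext z; simp only [Finset.mem_filter, Finset.mem_inter]
    constructor
    · rintro ⟨⟨h1, h2⟩, h3⟩; exact ⟨⟨h1, h3⟩, h2, (hD z).mp h3⟩
    · rintro ⟨⟨h1, h3⟩, h2, _⟩; exact ⟨⟨h1, h2⟩, h3⟩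
  have i4 : (A.filter (fun z => κ z ∈ B)).filter (fun z => z ∉ D) = (A \ D).filter (fun z => κ z ∈ B \ D) := by
    ext z; simp only [Finset.mem_filter, Finset.mem_sdiff]
    constructor
    · rintro ⟨⟨h1, h2⟩, h3⟩; exact ⟨⟨h1, h3⟩, h2, fun h4 => h3 ((hD z).mpr h4)⟩
    · rintro ⟨⟨h1, h3⟩, h2, _⟩; exact ⟨⟨h1, h2⟩, h3⟩
  rw [i1, i2] at e1; rw [i3, i4] at e2
  push_cast [e1, e2]
  ring

/-- **The diagonal part is the pulled-back functional.**  `δ : T → Z` injective with image `D` (every point of `D` is a `δ s`, every `δ s` lies in `D`)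
and `κ (δ s) = δ (ι' s)`.  Then for finite `A, B ⊆ Z`, with `A° := {s : δ s ∈ A}`, `B° := {s : δ s ∈ B}` (finite since `T` is finite):
`#((A∩D) ∩ (B∩D)) - #{z ∈ A∩D : κ z ∈ B∩D} = #(A° ∩ B°) - #{s ∈ A° : ι' s ∈ B°}`. [this work] -/
theorem R_diag_eq [Fintype T] (δ : T → Z) (hδ : Function.Injective δ) (ι' : T → T) (κ : Z → Z) (hκδ : ∀ s, κ (δ s) = δ (ι' s))
    (D : Finset Z) (hDδ : ∀ s, δ s ∈ D) (hDsurj : ∀ z ∈ D, ∃ s, δ s = z) (A B : Finset Z) :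
    (((A ∩ D) ∩ (B ∩ D)).card : ℤ) - (((A ∩ D).filter (fun z => κ z ∈ B ∩ D)).card : ℤ)
      = (((Finset.univ.filter (fun s => δ s ∈ A)) ∩ (Finset.univ.filter (fun s => δ s ∈ B))).card : ℤ)
        - (((Finset.univ.filter (fun s => δ s ∈ A)).filter (fun s => ι' s ∈ Finset.univ.filter (fun t => δ t ∈ B))).card : ℤ) := by
  classical
  -- both D-side sets are images under δ of the T-side sets
  have j1 : (A ∩ D) ∩ (B ∩ D) = ((Finset.univ.filter (fun s => δ s ∈ A)) ∩ (Finset.univ.filter (fun s => δ s ∈ B))).image δ := by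
    ext z; simp only [Finset.mem_inter, Finset.mem_image, Finset.mem_filter, Finset.mem_univ, true_and]
    constructor
    · rintro ⟨⟨hA, hD⟩, hB, _⟩
      obtain ⟨s, rfl⟩ := hDsurj z hD
      exact ⟨s, ⟨hA, hB⟩, rfl⟩
    · rintro ⟨s, ⟨hA, hB⟩, rfl⟩; exact ⟨⟨hA, hDδ s⟩, hB, hDδ s⟩
  have j2 : (A ∩ D).filter (fun z => κ z ∈ B ∩ D) =
      ((Finset.univ.filter (fun s => δ s ∈ A)).filter (fun s => ι' s ∈ Finset.univ.filter (fun t => δ t ∈ B))).image δ := by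
    ext z; simp only [Finset.mem_inter, Finset.mem_image, Finset.mem_filter, Finset.mem_univ, true_and]
    constructor
    · rintro ⟨⟨hA, hD⟩, hB, _⟩
      obtain ⟨s, rfl⟩ := hDsurj z hD
      refine ⟨s, ⟨hA, ?_⟩, rfl⟩
      rw [hκδ] at hB; exact hB
    · rintro ⟨s, ⟨hA, hB⟩, rfl⟩
      refine ⟨⟨hA, hDδ s⟩, ?_, ?_⟩
      · rw [hκδ]; exact hB
      · rw [hκδ]; exact hDδ _
  rw [j1, j2, Finset.card_image_of_injective _ hδ, Finset.card_image_of_injective _ hδ]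

/-- **THEOREM S⁺ SKELETON (neutrality of hanging an atom).**  With `D` a `κ`-stable set carrying `T` isomorphically via `δ` (`κ ∘ δ = δ ∘ ι'`):
if the pulled-back pair has `R_T ≥ m` and the antidiagonal part `R_{Z∖D}(𝐀∖D, 𝐁∖D)` is nonnegative (in the application: the antidiagonal is a product
of an (R)-poset with antipodal-Kleitman factors, THEOREM R₀), then `R_Z(𝐀,𝐁) ≥ m`.  With `m = min R_T` and the template of `AntitheticStalk.stalk_transfer`
(which realises every value of `R_T` on `Z`), `min R_Z = min R_T`. [this work] -/
theorem neutrality_skeleton [Fintype T] (δ : T → Z) (hδ : Function.Injective δ) (ι' : T → T) (κ : Z → Z) (hκδ : ∀ s, κ (δ s) = δ (ι' s))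
    (D : Finset Z) (hD : ∀ z, z ∈ D ↔ κ z ∈ D) (hDδ : ∀ s, δ s ∈ D) (hDsurj : ∀ z ∈ D, ∃ s, δ s = z)
    (m : ℤ) (A B : Finset Z)
    (hT : m ≤ (((Finset.univ.filter (fun s => δ s ∈ A)) ∩ (Finset.univ.filter (fun s => δ s ∈ B))).card : ℤ)
        - (((Finset.univ.filter (fun s => δ s ∈ A)).filter (fun s => ι' s ∈ Finset.univ.filter (fun t => δ t ∈ B))).card : ℤ))
    (hoff : 0 ≤ ((((A \ D) ∩ (B \ D)).card : ℤ) - (((A \ D).filter (fun z => κ z ∈ B \ D)).card : ℤ))) :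
    m ≤ ((A ∩ B).card : ℤ) - ((A.filter (fun z => κ z ∈ B)).card : ℤ) := by
  rw [R_split κ D hD A B, R_diag_eq δ hδ ι' κ hκδ D hDδ hDsurj A B]
  linarith

end AntitheticStalkSplit

end Summit.CriticalPhenomena.PercolationContinuityZ3.Theorems
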